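import Summits.AtomisticToContinuum.Crystallization.Theorems.FreeSplittingCertificatesRadiusLadderRational
import Summits.AtomisticToContinuum.Crystallization.Theorems.FreeSplittingCertificatesRadiusLadderHardCoreFree

/-!
# Free splitting certificates — the radius ladder on `ℚ³`, II: crux r2 is a statement about finite subsets of `ℚ³`
(route `FreeSplittingCertificates`, crux r2 `FiniteRangeSplitting`, stmt-AtomisticToContinuum-12559)

VALUE = a structural theorem about the crux and about its LP falsifier (every refutation of a rung has an exact
rational witness) — NOT summit progress.

* `RungAtQ δ R` : the RATIONAL rung — some rule read at radius `R` is feasible on every finite `δ`-separated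
  configuration with rational coordinates; `lennardJones_dist_rat` : its LPs have rational bond energies;
* `exists_rat_zoo_of_not_rungAt` : `¬ RungAt δ R` ⟹ for all `0 < δ' < δ` and `R' < R` some finite zoo of
  rational `δ'`-separated configurations admits no feasible rule at radius `R'` (part I: refute with a margin at
  a generic radius `R'' ∈ (R', R)`, perturb rationally preserving the recurrences, transport back);
* `not_rungAtQ_of_not_rungAt`, `rungAt_of_rungAtQ` : the rational rungs interleave the rungs,
  `RungAt δ R → RungAtQ δ R` and `RungAtQ δ' R' → RungAt δ R` (`δ' < δ`, `R' < R`);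
* `finiteRangeSplitting_iff_rungAtQ_third` : crux r2 `↔ ∃ R > 0, RungAtQ (1/3) R`;
* `finiteRangeSplitting_iff_rational_uniform` : crux r2 `↔` ONE radius and ONE rule certify `e_∞ ≤` weighted
  site energy at every site of every finite set of distinct points of `ℚ³`;
* `not_finiteRangeSplitting_iff_rat_zoos` : crux r2 FAILS iff at every radius some finite zoo of
  `1/3`-separated rational configurations — finitely many LP rows with rational coefficients apart from the
  threshold `e_∞` — has no feasible rule.

So the crux and each of its potential refutations live over `ℚ³`: up to the single real constant `e_∞`, the
radius-ladder certificates (RESULTS-R2) are questions of exact rational linear programming.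
-/

noncomputable section

open scoped BigOperators Classical
open Filter Topology
open Literature.MathematicalPhysics.StatisticalMechanics

namespace Summit.AtomisticToContinuum.Crystallization.Theorems.StrictSplittingRuleBirth

/-- Euclidean `3`-space. -/
local notation "E3" => EuclideanSpace ℝ (Fin 3)

/-! ## 1. Rational configurations and the rational rung -/

/-- A finite configuration is RATIONAL when every coordinate of every point is a rational number. [folklore] -/
def IsRat {N : ℕ} (x : Fin N → E3) : Prop := ∀ (i : Fin N) (a : Fin 3), ∃ q : ℚ, x i a = q

/-- The RATIONAL RUNG: some pair-splitting rule read at radius `R` is feasible on every finite RATIONAL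
`δ`-separated configuration. [folklore] -/
def RungAtQ (δ R : ℝ) : Prop :=
  ∃ Φ : E3 → Finset E3 → ℝ, IsRule Φ ∧
    ∀ (N : ℕ) (x : Fin N → E3), IsRat x → Sep δ x → ∀ i : Fin N, eInf ≤ siteE R Φ x i

/-- A rung is a rational rung. -/
theorem rungAtQ_of_rungAt {δ R : ℝ} (h : RungAt δ R) : RungAtQ δ R := by
  obtain ⟨Φ, hr, hf⟩ := h
  exact ⟨Φ, hr, fun N x _ hx i => hf N x hx i⟩

/-- The rational rungs form a ladder in the radius (truncate the pattern). -/
theorem rungAtQ_mono_radius {δ R R' : ℝ} (hRR' : R ≤ R') : RungAtQ δ R → RungAtQ δ R' := by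
  rintro ⟨Φ, hr, hf⟩
  refine ⟨truncate R Φ, isRule_truncate hr, fun N x hq hx i => ?_⟩
  rw [siteE_truncate hRR']
  exact hf N x hq hx i

/-- The rational rungs form a ladder in the hard core. -/
theorem rungAtQ_mono_sep {δ δ' R : ℝ} (hδ : δ ≤ δ') : RungAtQ δ R → RungAtQ δ' R := by
  rintro ⟨Φ, hr, hf⟩
  exact ⟨Φ, hr, fun N x hq hx i => hf N x hq (fun a b hab => hδ.trans (hx a b hab)) i⟩

/-- **Rational configurations have rational LP data**: the Lennard-Jones energy of a bond between rational
points is a rational number (`V(r) = (1/12)(r²)⁻⁶ - (1/6)(r²)⁻³` and `r² ∈ ℚ`). -/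
theorem lennardJones_dist_rat {N : ℕ} {x : Fin N → E3} (hx : IsRat x) (i j : Fin N) :
    ∃ q : ℚ, lennardJones (dist (x i) (x j)) = q := by
  choose f hf using hx
  have hsq : dist (x i) (x j) ^ 2 = ((∑ a, (f i a - f j a) ^ 2 : ℚ) : ℝ) := by
    rw [EuclideanSpace.dist_eq, Real.sq_sqrt (Finset.sum_nonneg fun a _ => sq_nonneg _)]
    push_cast
    refine Finset.sum_congr rfl fun a _ => ?_
    rw [Real.dist_eq, sq_abs, hf i a, hf j a]
  obtain ⟨q, hq⟩ : ∃ q : ℚ, dist (x i) (x j) ^ 2 = q := ⟨_, hsq⟩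
  refine ⟨1 / 12 * (q ^ 6)⁻¹ - 1 / 6 * (q ^ 3)⁻¹, ?_⟩
  unfold lennardJones
  rw [inv_pow, inv_pow, show dist (x i) (x j) ^ 12 = (dist (x i) (x j) ^ 2) ^ 6 by ring,
    show dist (x i) (x j) ^ 6 = (dist (x i) (x j) ^ 2) ^ 3 by ring, hq]
  push_cast
  ring

/-! ## 2. Every non-rung has a rational refuting zoo -/

/-- **Rational refuting zoos.**  If there is no rung at `(δ, R)`, then for all `0 < δ' < δ` and `R' < R` some
finite zoo of RATIONAL `δ'`-separated configurations admits no feasible rule at radius `R'`.  (Take a refuting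
zoo `Z` at `(δ, R)` (`exists_zoo_of_not_rungAt`), a generic radius `R'' ∈ (R', R)` avoiding the distances of `Z`
— `Z` refutes at `R''` by truncation, with a margin `ε` — and a rational perturbation at accuracy `ε/2`
preserving memberships at `R''` and all coincidences of bond vectors, hence all recurrences of realised keys; a
rule feasible on the perturbed zoo would transport back to a rule within `ε/2` of feasible on `Z`.) -/
theorem exists_rat_zoo_of_not_rungAt {δ δ' R R' : ℝ} (hδ' : 0 < δ') (hδ : δ' < δ) (hR : R' < R)
    (h : ¬ RungAt δ R) :
    ∃ Y : Finset Conf, (∀ c ∈ Y, IsRat c.2) ∧ (∀ c ∈ Y, Sep δ' c.2) ∧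
      ∀ Φ : E3 → Finset E3 → ℝ, IsRule Φ → ∃ c ∈ Y, ∃ i : Fin c.1, siteE R' Φ c.2 i < eInf := by
  classical
  obtain ⟨Z, hsep, href⟩ := exists_zoo_of_not_rungAt h
  have hZ : ∀ c ∈ Z, Function.Injective c.2 := fun c hc =>
    perturbative_injective_of_sep (hδ'.trans hδ) (hsep c hc)
  -- a generic intermediate radius
  let D : Finset ℝ := (Z.sigma fun c => (Finset.univ : Finset (Fin c.1 × Fin c.1))).image
    fun b => dist (b.1.2 b.2.1) (b.1.2 b.2.2)
  obtain ⟨R'', ⟨hR''1, hR''2⟩, hR''D⟩ := (Set.Ioo_infinite hR).exists_notMem_finset D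
  have hgen : ∀ c ∈ Z, ∀ l i : Fin c.1, dist (c.2 l) (c.2 i) ≠ R'' := fun c hc l i heq =>
    hR''D (Finset.mem_image.2 ⟨⟨c, (l, i)⟩, Finset.mem_sigma.2 ⟨hc, Finset.mem_univ _⟩, heq⟩)
  have href'' : ∀ Φ : E3 → Finset E3 → ℝ, IsRule Φ → ∃ c ∈ Z, ∃ i : Fin c.1, siteE R'' Φ c.2 i < eInf := by
    intro Φ hΦ
    obtain ⟨c, hc, i, hlt⟩ := href (truncate R'' Φ) (isRule_truncate hΦ)
    rw [siteE_truncate hR''2.le] at hlt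
    exact ⟨c, hc, i, hlt⟩
  obtain ⟨ε, hε, hmargin⟩ := exists_margin_of_refuting R'' Z href''
  obtain ⟨y, hrat, hsep', hmem, hrel, hener⟩ := exists_rat_perturbation Z hZ hgen hsep hδ (half_pos hε)
  have hinj : ∀ c ∈ Z, Function.Injective (y c) := fun c hc =>
    perturbative_injective_of_sep hδ' (hsep' c hc)
  refine ⟨Z.image fun c => (⟨c.1, y c⟩ : Conf), fun c' hc' => ?_, fun c' hc' => ?_, fun Φ hΦ => ?_⟩
  · obtain ⟨c, hc, rfl⟩ := Finset.mem_image.1 hc'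
    exact hrat c hc
  · obtain ⟨c, hc, rfl⟩ := Finset.mem_image.1 hc'
    exact hsep' c hc
  · by_contra hno
    push Not at hno
    obtain ⟨Ψ, hΨ, hrows⟩ := exists_rule_of_perturbed R'' Z y hinj
      (fun b hb b' hb' hk => zkey_transport R'' Z y hmem hrel hb hb' hk) (isRule_truncate (R := R') hΦ)
    obtain ⟨c, hc, i, hlt⟩ := hmargin Ψ hΨ
    have h1 := hrows c hc i
    rw [siteE_truncate hR''1.le] at h1
    have h2 : eInf ≤ siteE R' Φ (y c) i := hno ⟨c.1, y c⟩ (Finset.mem_image_of_mem _ hc) i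
    have h3 := hener c hc i
    linarith

/-- **Rational reduction of the radius ladder**: no rung at `(δ, R)` ⟹ no rational rung at any `(δ', R')` with
`0 < δ' < δ`, `R' < R`. -/
theorem not_rungAtQ_of_not_rungAt {δ δ' R R' : ℝ} (hδ' : 0 < δ') (hδ : δ' < δ) (hR : R' < R)
    (h : ¬ RungAt δ R) : ¬ RungAtQ δ' R' := by
  obtain ⟨Y, hrat, hsep, href⟩ := exists_rat_zoo_of_not_rungAt hδ' hδ hR h
  rintro ⟨Φ, hΦ, hf⟩
  obtain ⟨c, hc, i, hlt⟩ := href Φ hΦ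
  exact (not_lt.2 (hf c.1 c.2 (hrat c hc) (hsep c hc) i)) hlt

/-- A rational rung gives a rung at every strictly larger hard core and radius. -/
theorem rungAt_of_rungAtQ {δ δ' R R' : ℝ} (hδ' : 0 < δ') (hδ : δ' < δ) (hR : R' < R) (h : RungAtQ δ' R') :
    RungAt δ R := by
  by_contra hn
  exact not_rungAtQ_of_not_rungAt hδ' hδ hR hn h

/-! ## 3. Crux r2 on `ℚ³` -/

/-- **Crux r2 `↔` rational rungs at every hard core**: `FiniteRangeSplitting ↔ ∀ δ > 0, ∃ R > 0, RungAtQ δ R`. -/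
theorem finiteRangeSplitting_iff_rungAtQ :
    Summit.AtomisticToContinuum.Crystallization.Theses.FreeSplittingCertificates.FiniteRangeSplitting ↔
      ∀ δ : ℝ, 0 < δ → ∃ R : ℝ, 0 < R ∧ RungAtQ δ R := by
  rw [finiteRangeSplitting_iff_rung]
  refine ⟨fun h δ hδ => ?_, fun h δ hδ => ?_⟩
  · obtain ⟨R, hR, hrung⟩ := h δ hδ
    exact ⟨R, hR, rungAtQ_of_rungAt hrung⟩
  · obtain ⟨R, hR, hQ⟩ := h (δ / 2) (half_pos hδ)
    exact ⟨R + 1, by linarith, rungAt_of_rungAtQ (half_pos hδ) (half_lt_self hδ) (lt_add_one R) hQ⟩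

/-- **Crux r2 is ONE rational rung**: `FiniteRangeSplitting ↔ ∃ R > 0, RungAtQ (1/3) R` — some pair-splitting
rule at some radius is feasible on every finite `1/3`-separated subset of `ℚ³` (hard core `2/5` of
`finiteRangeSplitting_iff_rung_two_fifths`, lowered to `1/3` to absorb the perturbation). -/
theorem finiteRangeSplitting_iff_rungAtQ_third :
    Summit.AtomisticToContinuum.Crystallization.Theses.FreeSplittingCertificates.FiniteRangeSplitting ↔
      ∃ R : ℝ, 0 < R ∧ RungAtQ (1 / 3) R := by
  refine ⟨fun h => ?_, fun ⟨R, hR, hQ⟩ => ?_⟩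
  · obtain ⟨R, hR, hrung⟩ := finiteRangeSplitting_iff_rung.1 h (1 / 3) (by norm_num)
    exact ⟨R, hR, rungAtQ_of_rungAt hrung⟩
  · exact finiteRangeSplitting_iff_rung_two_fifths.2
      ⟨R + 1, by linarith, rungAt_of_rungAtQ (by norm_num) (by norm_num) (lt_add_one R) hQ⟩

/-- **Crux r2 without hard cores, on `ℚ³`**: `FiniteRangeSplitting` holds iff ONE radius and ONE rule certify
`e_∞ ≤` weighted site energy at every site of every finite set of distinct RATIONAL points. -/
theorem finiteRangeSplitting_iff_rational_uniform :
    Summit.AtomisticToContinuum.Crystallization.Theses.FreeSplittingCertificates.FiniteRangeSplitting ↔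
      ∃ R : ℝ, 0 < R ∧ ∃ Φ : E3 → Finset E3 → ℝ, IsRule Φ ∧
        ∀ (N : ℕ) (x : Fin N → E3), IsRat x → Function.Injective x → ∀ i : Fin N, eInf ≤ siteE R Φ x i := by
  refine ⟨fun h => ?_, fun ⟨R, hR, Φ, hΦ, hf⟩ => ?_⟩
  · obtain ⟨R, hR, Φ, hΦ, hf⟩ := finiteRangeSplitting_iff_uniform.1 h
    exact ⟨R, hR, Φ, hΦ, fun N x _ hx i => hf N x hx i⟩
  · exact finiteRangeSplitting_iff_rungAtQ_third.2
      ⟨R, hR, Φ, hΦ, fun N x hq hx i => hf N x hq (perturbative_injective_of_sep (by norm_num) hx) i⟩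

/-- **Every failure of crux r2 has exact rational certificates**: `¬ FiniteRangeSplitting` iff at EVERY radius
some finite zoo of `1/3`-separated configurations in `ℚ³` — an LP with rational bond energies
(`lennardJones_dist_rat`) — admits no feasible pair-splitting rule. -/
theorem not_finiteRangeSplitting_iff_rat_zoos :
    ¬ Summit.AtomisticToContinuum.Crystallization.Theses.FreeSplittingCertificates.FiniteRangeSplitting ↔
      ∀ R : ℝ, ∃ Y : Finset Conf, (∀ c ∈ Y, IsRat c.2) ∧ (∀ c ∈ Y, Sep (1 / 3) c.2) ∧
        ∀ Φ : E3 → Finset E3 → ℝ, IsRule Φ → ∃ c ∈ Y, ∃ i : Fin c.1, siteE R Φ c.2 i < eInf := by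
  refine ⟨fun h R => ?_, fun h hfrs => ?_⟩
  · have hn : ¬ RungAt (2 / 5) (|R| + 1) := fun hr =>
      h (finiteRangeSplitting_iff_rung_two_fifths.2 ⟨|R| + 1, by positivity, hr⟩)
    exact exists_rat_zoo_of_not_rungAt (by norm_num) (by norm_num) (by linarith [le_abs_self R]) hn
  · obtain ⟨R, hR, Φ, hΦ, hf⟩ := finiteRangeSplitting_iff_rungAtQ_third.1 hfrs
    obtain ⟨Y, hrat, hsep, href⟩ := h R
    obtain ⟨c, hc, i, hlt⟩ := href Φ hΦ
    exact (not_lt.2 (hf c.1 c.2 (hrat c hc) (hsep c hc) i)) hlt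

end Summit.AtomisticToContinuum.Crystallization.Theorems.StrictSplittingRuleBirth

end
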